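import Literature.NumberTheory.EllipticCurves.NeronModelExistence
import Literature.NumberTheory.EllipticCurves.NeronModelBaseChange
import Literature.AlgebraicGeometry.Limits.LocalizationSchemeDescent
import Literature.AlgebraicGeometry.Limits.LocalizationSmoothSpread
import Literature.AlgebraicGeometry.Limits.LocalizationSeparatedSpread
import Literature.AlgebraicGeometry.Limits.LocalizationGroupSpread
import Literature.AlgebraicGeometry.Limits.LocalizationProperSpread
import Literature.AlgebraicGeometry.Limits.GenericProperCover
import HarnessLib

/-!
# Spreading out an abelian variety to a proper smooth group scheme over a dense open subset — proof

This file discharges the named fact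
`Literature.NumberTheory.EllipticCurves.exists_abelianScheme_away` of
`Literature.NumberTheory.EllipticCurves.NeronModelExistence` (Milne, *Abelian Varieties*,
Rem. 20.9, p. 146; the first step of the proof of Bosch–Lütkebohmert–Raynaud, *Néron Models*,
Thm. 1.4/3): for an abelian variety `E` (a proper, geometrically integral group scheme) over the
fraction field `K` of a Dedekind domain `R` there is `f ≠ 0` in `R` such that over every model
`R'` of `R[1/f]` there is a proper smooth `R'`-group scheme whose generic fibre is `E` as a group
scheme (`exists_abelianScheme_away_holds`).

## Proof

Milne's printed proof ("choose a projective embedding, take the closure in `ℙⁿ_S`, shrink")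
needs the projectivity of abelian varieties, whose proof in this tree still rests on the
finiteness of coherent cohomology (`Motives.AbelianVariety.isProjectiveOver`,
`cechComplex_pseudoCoherent_general`). We follow instead the route of BLR §1.4 / EGA IV₃ §8
through the limit `Spec K = lim_{f ≠ 0} Spec R[1/f]` (`Literature/AlgebraicGeometry/Limits/Localization*`),
with Chow's lemma replacing the projective embedding in the properness step (the proof of Stacks,
Tag 081F):

1. *Descent of `E`* (EGA IV₃ 8.8.2 (ii), Stacks 01ZM; `LocApprox.exists_iso_pullback`): `E` is
   smooth (`smooth_hom_of_isProper_of_geometricallyIntegral`), hence of finite presentation, and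
   quasi-compact and separated, so `E ≅ P ×_R K` for an `R`-scheme `P` of finite presentation.
2. *Chow cover* (`Limits/GenericProperCover`, via `Resolution/ChowLemmaRing.chow_proper`): a proper
   `R`-scheme `Y` (the closure in `ℙⁿ_R` of a Chow cover `X' ↠ E`, `X' ⊆ ℙⁿ_K`) with an
   `R`-morphism `Y ⊗ Spec K → P` surjective onto `P ⊗ Spec K`; it spreads out to a stage
   `Y ⊗ Spec R[1/s] → P` (Stacks 01ZC, `LocApprox.exists_whiskerLeft_comp_eq`).
3. *Shrinking*: smoothness and separatedness of `P ⊗ Spec R[1/t] → Spec R[1/t]` for all small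
   stages (Stacks 0C0C, `LocApprox.exists_forall_smooth_snd`; EGA IV₃ 8.10.5 (v),
   `exists_forall_isSeparated_snd`), then properness (`LocApprox.isProper_snd_of_generic_cover`,
   Stacks 081F: the spread-out Chow cover is proper with closed image containing the generic
   fibre, hence surjective).
4. *Group law* (EGA IV₃ 8.8.2 (i) for the diagrams of a group object;
   `Limits/LocalizationGroupSpread`): the multiplication, unit and inverse of `P ⊗ Spec K ≅ E`
   spread out to a stage and satisfy the group axioms over every flat separated stage, because
   restriction to `Spec K` is injective on morphisms from flat `R[1/t]`-schemes to the separated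
   `P ⊗ Spec R[1/t]` (schematic density of the generic fibre); the canonical
   `(P_t)_K ≅ P_K ≅ E` is an isomorphism of group schemes.
5. *Any model `R'` of `R[1/t]`*: base change along `Spec R' → Spec R[1/t]` (the `R`-algebra map
   `R[1/t] → R'`; `Spec K → Spec R'→ Spec R[1/t]` is the leg of the limit cone), using
   `NeronModelBaseChange.exists_iso_pullback_pullback` for the generic fibre.

## References

* J. S. Milne, *Abelian Varieties*, in Cornell–Silverman (eds.), *Arithmetic Geometry* (1986),
  §20, Rem. 20.9 (p. 146). [Milne1986AbelianVarieties]
* S. Bosch, W. Lütkebohmert, M. Raynaud, *Néron Models*, Springer 1990, §1.4, proof of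
  Thm. 1.4/3 (via EGA IV₃ 8.8.2, 8.10.5, IV₄ 17.7.8). [BLRNeronModels1990]
* A. Grothendieck, EGA IV₃, Thm. 8.8.2, Thm. 8.10.5 (Publ. Math. IHÉS 28, 1966). [EGAIV3]
* The Stacks project, Tags 01ZM, 01ZC, 0C0C, 081F, 02O2. [StacksProject]
-/

noncomputable section

universe u

open CategoryTheory CategoryTheory.Limits AlgebraicGeometry MonoidalCategory
  CartesianMonoidalCategory MonObj
open Literature.AlgebraicGeometry.Limits Literature.AlgebraicGeometry.Limits.LocApprox
open Literature.AlgebraicGeometry.Motives (SchemeOver specOver)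
open scoped CategoryTheory.Obj

namespace Literature.NumberTheory.EllipticCurves

set_option backward.isDefEq.respectTransparency false

section Lemmas

variable {R : Type u} [CommRing R] [IsDomain R] (K : Type u) [Field K] [Algebra R K]
  [IsFractionRing R K]

omit [IsDomain R] in
/-- The maps `R[1/t] → K = Frac R` of the limit cone `Spec K = lim Spec R[1/t]` are injective
(`t` a non-zero-divisor). [folklore] -/
theorem toLoc_injective (t : Idx (nonZeroDivisors R)) :
    Function.Injective (toLoc (nonZeroDivisors R) K t) := by
  refine IsLocalization.injective_of_map_algebraMap_zero (M := Submonoid.powers t.val)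
    (S := loc (nonZeroDivisors R) t) (toLoc (nonZeroDivisors R) K t) fun x hx => ?_
  have h : toLoc (nonZeroDivisors R) K t (algebraMap R _ x) = algebraMap R K x :=
    RingHom.congr_fun (toLoc_comp_algebraMap (nonZeroDivisors R) K t) x
  rw [h] at hx
  have hx0 : x = 0 := (map_eq_zero_iff _ (IsFractionRing.injective R K)).mp hx
  rw [hx0, map_zero]

/-- Hence the legs `Spec K → Spec R[1/t]` are schematically dominant. [folklore] -/
theorem isSchemeTheoreticallyDominant_leg_left (t : Idx (nonZeroDivisors R)) :
    IsSchemeTheoreticallyDominant (leg (nonZeroDivisors R) K t).left := by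
  haveI : IsDomain (loc (nonZeroDivisors R) t) :=
    IsLocalization.isDomain_of_le_nonZeroDivisors (M := Submonoid.powers t.val) _
      (powers_le_nonZeroDivisors_of_noZeroDivisors (nonZeroDivisors.ne_zero t.mem))
  exact isSchemeTheoreticallyDominant_specMap_of_injective _ (toLoc_injective K t)

end Lemmas

/-- **Spreading out an abelian variety to a proper smooth group scheme over a dense open subset**
(Milne, *Abelian Varieties*, Rem. 20.9; BLR, *Néron Models*, proof of Thm. 1.4/3): discharge of
the named fact `exists_abelianScheme_away`, along the route described in the module docstring
(descent of `E` through `Spec K = lim Spec R[1/f]`, Chow cover for properness, descent of the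
group law, shrinking for smoothness and separatedness).
[cite: Milne1986AbelianVarieties, Rem. 20.9 (§20, p. 146)] [cite: EGAIV3, Thm. 8.8.2 and Thm. 8.10.5]
[cite: StacksProject, Tags 01ZM, 01ZC, 0C0C, 081F] -/
theorem exists_abelianScheme_away_holds : exists_abelianScheme_away.{u} := by
  intro R _ _ K _ _ _ E _ _ _
  classical
  -- Step 1: descend `E` to an `R`-scheme `P` of finite presentation
  haveI : Smooth E.hom := smooth_hom_of_isProper_of_geometricallyIntegral E
  obtain ⟨P, hqc, hqs, hlfp, ⟨e₀⟩⟩ :=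
    LocApprox.exists_iso_pullback (S := nonZeroDivisors R) (B := K) (X := E)
  haveI := hqc
  haveI := hqs
  haveI := hlfp
  -- the group structure on `P_K = P ×_R K`, transported from `E`
  letI : GrpObj (limObj K P) := GrpObj.ofIso e₀.symm
  haveI hε : IsMonHom e₀.symm.hom := isMonHom_ofIso e₀.symm
  haveI : IsMonHom e₀.hom := inferInstanceAs (IsMonHom e₀.symm.inv)
  -- Step 2: a proper `R`-scheme `Y` generically covering `P`, spread out to a stage
  haveI : Subsingleton (Spec (CommRingCat.of K)) :=
    inferInstanceAs (Subsingleton (PrimeSpectrum K))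
  haveI : IsIntegral E.left := GeometricallyIntegral.isIntegral_of_subsingleton E.hom
  obtain ⟨Y, a, hY, ha⟩ := exists_proper_generic_cover P E e₀
  haveI := hY
  obtain ⟨s₁, g, hg⟩ := LocApprox.exists_whiskerLeft_comp_eq K (S := nonZeroDivisors R) (P := Y) a
  -- Step 3 (beginning): smoothness and separatedness of the stages
  have hgen : pullback.snd P.hom (Spec.map (CommRingCat.ofHom (algebraMap R K))) =
      e₀.hom.left ≫ E.hom := (Over.w e₀.hom).symm
  have hsmK : Smooth (pullback.snd P.hom (Spec.map (CommRingCat.ofHom (algebraMap R K)))) := by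
    rw [hgen]; infer_instance
  have hsepK : IsSeparated (pullback.snd P.hom (Spec.map (CommRingCat.ofHom (algebraMap R K)))) := by
    rw [hgen]; infer_instance
  obtain ⟨s₂, hs₂S, hs₂⟩ := LocApprox.exists_forall_smooth_snd (nonZeroDivisors R) K P hsmK
  obtain ⟨s₃, hs₃S, hs₃⟩ := LocApprox.exists_forall_isSeparated_snd (nonZeroDivisors R) K P hsepK
  -- Step 4 (beginning): spreading out the group law
  obtain ⟨s₄, ⟨d₄⟩⟩ := LocApprox.exists_grpSpread (nonZeroDivisors R) K P
  -- a common stage `t`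
  let t : Idx (nonZeroDivisors R) :=
    ⟨s₁.val * s₄.val * (s₂ * s₃), mul_mem (mul_mem s₁.mem s₄.mem) (mul_mem hs₂S hs₃S)⟩
  have ht₁ : t ≤ s₁ := Idx.le_iff.mpr (dvd_mul_of_dvd_left (dvd_mul_right _ _) _)
  have ht₄ : t ≤ s₄ := Idx.le_iff.mpr (dvd_mul_of_dvd_left (dvd_mul_left _ _) _)
  have ht₂ : s₂ ∣ t.val := dvd_mul_of_dvd_right (dvd_mul_right _ _) _
  have ht₃ : s₃ ∣ t.val := dvd_mul_of_dvd_right (dvd_mul_left _ _) _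
  haveI hsm : Smooth (pullback.snd P.hom ((baseDiagram (nonZeroDivisors R)).obj t).hom) :=
    hs₂ t.val ht₂ (loc (nonZeroDivisors R) t)
  haveI hsep : IsSeparated (pullback.snd P.hom ((baseDiagram (nonZeroDivisors R)).obj t).hom) :=
    hs₃ t.val ht₃ (loc (nonZeroDivisors R) t)
  haveI : Flat (pullback.snd P.hom ((baseDiagram (nonZeroDivisors R)).obj t).hom) := inferInstance
  -- Step 3 (end): properness over the stage `t`, by the spread-out Chow cover
  have hgt : (Y ◁ leg (nonZeroDivisors R) K t) ≫ ((Y ◁ (baseDiagram _).map (homOfLE ht₁)) ≫ g) = a := by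
    rw [← MonoidalCategory.whiskerLeft_comp_assoc, leg_comp_map, hg]
  have ha' : Function.Surjective (lift ((Y ◁ leg (nonZeroDivisors R) K t) ≫
      ((Y ◁ (baseDiagram _).map (homOfLE ht₁)) ≫ g)) (snd Y (specOver R K))).left := by
    rw [hgt]; exact ha
  haveI hpr : IsProper (pullback.snd P.hom ((baseDiagram (nonZeroDivisors R)).obj t).hom) :=
    isProper_snd_of_generic_cover (B := K) le_rfl Y P t _ ha'
  -- Step 4 (end): the group structure on the stage `P_t`
  haveI : Flat (stageObj (nonZeroDivisors R) P t).hom := ‹Flat (pullback.snd P.hom _)›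
  haveI : IsSeparated (stageObj (nonZeroDivisors R) P t).hom := hsep
  haveI : IsSchemeTheoreticallyDominant (leg (nonZeroDivisors R) K t).left :=
    isSchemeTheoreticallyDominant_leg_left K t
  let d : GrpSpread (nonZeroDivisors R) K P t := d₄.restrict (homOfLE ht₄)
  letI : GrpObj (stageObj (nonZeroDivisors R) P t) := d.grpObj
  haveI hmon := d.isMonHom_legFacObjIso_hom
  have H : ∃ e : (Over.pullback (leg (nonZeroDivisors R) K t).left).obj
      (stageObj (nonZeroDivisors R) P t) ≅ E, IsMonHom e.hom :=
    ⟨legFacObjIso (nonZeroDivisors R) K t P ≪≫ e₀, by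
      rw [Iso.trans_hom]
      infer_instance⟩
  -- Step 5: `f := t`; any model `R'` of `R[1/t]`
  refine ⟨t.val, nonZeroDivisors.ne_zero t.mem, fun R' _ _ _ _ _ => ?_⟩
  let ψ : loc (nonZeroDivisors R) t →+* R' :=
    IsLocalization.Away.lift t.val (IsLocalization.Away.algebraMap_isUnit (S := R') t.val)
  have hψ : (algebraMap R' K).comp ψ = toLoc (nonZeroDivisors R) K t := by
    refine IsLocalization.ringHom_ext (Submonoid.powers t.val) ?_
    rw [RingHom.comp_assoc, IsLocalization.Away.lift_comp, toLoc_comp_algebraMap]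
    exact (IsScalarTower.algebraMap_eq R R' K).symm
  let υ : Spec (CommRingCat.of R') ⟶ ((baseDiagram (nonZeroDivisors R)).obj t).left :=
    Spec.map (CommRingCat.ofHom ψ)
  have hυ : specGenericPoint R' K ≫ υ = (leg (nonZeroDivisors R) K t).left := by
    change Spec.map _ ≫ Spec.map _ = Spec.map _
    rw [← Spec.map_comp, ← CommRingCat.ofHom_comp, hψ]
    rfl
  let 𝒜 : Grp (Over (Spec (CommRingCat.of R'))) :=
    (Over.pullback υ).mapGrp.obj (Grp.mk (stageObj (nonZeroDivisors R) P t))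
  refine ⟨𝒜, ?_, ?_, ?_⟩
  · exact MorphismProperty.pullback_snd (P := @IsProper) _ _ hpr
  · exact MorphismProperty.pullback_snd (P := @Smooth) _ _ hsm
  · exact exists_iso_pullback_pullback υ (specGenericPoint R' K)
      (stageObj (nonZeroDivisors R) P t) E hυ H

end Literature.NumberTheory.EllipticCurves

end
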